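import Summits.QuantumFields.YangMills.Theorems.BalabanUVNodesN18CombStepSecondOrderLipschitz
import Literature.Analysis.Complex.RungeUnits
import HarnessLib

/-!
# Prop 7, route-R E′, (E1-c) brick F3a — C^{1,1} LETTERS: SECOND DIFFERENCES OF POWERS AND OF THE EXPONENTIAL IN A BANACH ALGEBRA
# `‖(aⁿ − bⁿ) − (a′ⁿ − b′ⁿ)‖ ≤ n Rⁿ⁻¹·‖(a−b) − (a′−b′)‖ + n(n−1)Rⁿ⁻²·‖a′ − b′‖·(‖a − a′‖ + ‖b − b′‖)`, hence for `exp` with `e^R` in place of both coefficients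

Route `UnitScaleTilt`, crux K1 child «MinimiserStabilityRegPr» (`stmt-QuantumFields-19200`), cell ym3-torus, width seat px15 (gen 2); pen «px15 g2: (E1-c) GO-LOCATE» (★p1 g15,
2026-08-28T20:45:05Z), LOCATE `LOCATE-E1C-DIVLIPSCHITZ-px15g2.md` §3 (F3).  THEOREMS ONLY (0 `def`, 0 `sorry`); `--supports stmt-QuantumFields-19200`, count-neutral.
YM₃ on T³ is a ladder rung (R3), not the Clay problem; nothing here claims the stub, the crux, d = 4 or the mass gap.

WHY.  The Lipschitz constant of the DIVERGENCE of the chart remainder (LOCATE-E1 §3 (N) row 2) is a SECOND difference of the nonlinearity: `D*_W(N(ψ) − N(ψ′))(x) = Σ_μ {[N(ã_μ) − N(a_μ)] −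
[N(ã′_μ) − N(a′_μ)]}` (transported data vs data at `x`, for `ψ` and `ψ′`).  The lineage's letters (✓p656480∕p657531∕p658500) are FIRST differences (C¹); this file supplies the generic
second-difference (C^{1,1}) rows for powers and for `exp` — the exponential enters `N` through `u = e^{−iψ}`, `W e^{iψ₊}W* = e^{i(ψ+δ)}`, `E = e^{iD‴}` — with explicit constants, by the
elementary recurrence `aⁿ⁺¹ − bⁿ⁺¹ = a(aⁿ − bⁿ) + (a − b)bⁿ` and termwise domination of the exponential series (pattern of ✓ `Literature.Analysis.Complex.norm_exp_sub_exp_le`).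

WHAT IS PROVED (def-free; `𝔄` a complete normed algebra over `ℂ`; ns `…Theorems.Prop7PowerSeriesSecondDiff`).
* §1 `pow_succ_sub_pow_succ` (the recurrence; the FIRST-difference row `‖aⁿ⁺¹ − bⁿ⁺¹‖ ≤ (n+1)Rⁿ‖a − b‖` IS ✓ `YMDAG.N18.TransportOfRecord.norm_pow_succ_sub_pow_succ_le_of_le` — cited), `secondDiff_succ`,
  ★★ `norm_pow_secondDiff_le` (`‖(aⁿ⁺² − bⁿ⁺²) − (a′ⁿ⁺² − b′ⁿ⁺²)‖ ≤ (n+2)Rⁿ⁺¹·E + (n+2)(n+1)Rⁿ·D·S`, `E = ‖(a−b)−(a′−b′)‖`, `D = ‖a′−b′‖`, `S = ‖a−a′‖ + ‖b−b′‖`), and the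
  `n = 0, 1` cases.
* §2 ★★★ `norm_exp_secondDiff_le` — `‖(eᵃ − eᵇ) − (e^{a′} − e^{b′})‖ ≤ e^R·(E + D·S)` for `‖a‖, ‖b‖, ‖a′‖, ‖b′‖ ≤ R`.
HONEST SCOPE.  Elementary Banach-algebra calculus ([folklore]); the FIRST-order-with-smallness rows for `log(1+x) − x`, `eˣ − 1 − x` are ✓ `BalabanUVNodesN18CombStepSecondOrderLipschitz` (cited, imported); the `logOnePlus`∕`gSer` second-difference twins and the Taylor-2 row of the pure-gauge piece are the sequel (F3b).

References: T. Bałaban, CMP 98 (1985) 17–51 [Balaban1985Averaging] ((21)–(23) p.21, (31)–(33) p.22); B. C. Hall, *Lie Groups, Lie Algebras, and Representations*, 2nd ed. (2015),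
§5.4 [Hall2015].
-/

set_option autoImplicit false

noncomputable section

open NormedSpace
open scoped Nat

namespace Summit.QuantumFields.YangMills.Theorems.Prop7PowerSeriesSecondDiff

open YMDAG.N18.TransportOfRecord (norm_pow_succ_sub_pow_succ_le_of_le)

variable {𝔄 : Type*} [NormedRing 𝔄] [NormedAlgebra ℂ 𝔄] [CompleteSpace 𝔄]

/-! ## §1 Powers -/

section Powers

omit [NormedAlgebra ℂ 𝔄] [CompleteSpace 𝔄] in
/-- `aⁿ⁺¹ − bⁿ⁺¹ = a·(aⁿ − bⁿ) + (a − b)·bⁿ`. [folklore] -/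
theorem pow_succ_sub_pow_succ (a b : 𝔄) (n : ℕ) :
    a ^ (n + 1) - b ^ (n + 1) = a * (a ^ n - b ^ n) + (a - b) * b ^ n := by
  rw [pow_succ', pow_succ']; noncomm_ring

omit [NormedAlgebra ℂ 𝔄] [CompleteSpace 𝔄] in
/-- The recurrence for second differences: with `Δₙ := (aⁿ − bⁿ) − (a′ⁿ − b′ⁿ)`,
`Δₙ₊₁ = a·Δₙ + (a − a′)·(a′ⁿ − b′ⁿ) + ((a−b) − (a′−b′))·bⁿ + (a′ − b′)·(bⁿ − b′ⁿ)`. [folklore] -/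
theorem secondDiff_succ (a b a' b' : 𝔄) (n : ℕ) :
    (a ^ (n + 1) - b ^ (n + 1)) - (a' ^ (n + 1) - b' ^ (n + 1))
      = a * ((a ^ n - b ^ n) - (a' ^ n - b' ^ n)) + (a - a') * (a' ^ n - b' ^ n)
        + ((a - b) - (a' - b')) * b ^ n + (a' - b') * (b ^ n - b' ^ n) := by
  rw [pow_succ_sub_pow_succ, pow_succ_sub_pow_succ]; noncomm_ring

omit [NormedAlgebra ℂ 𝔄] [CompleteSpace 𝔄] in
/-- ★★ **SECOND DIFFERENCE OF POWERS**: for `‖a‖, ‖b‖, ‖a′‖, ‖b′‖ ≤ R` and every `n`,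
`‖(aⁿ⁺² − bⁿ⁺²) − (a′ⁿ⁺² − b′ⁿ⁺²)‖ ≤ (n+2)·Rⁿ⁺¹·‖(a−b) − (a′−b′)‖ + (n+2)(n+1)·Rⁿ·‖a′ − b′‖·(‖a − a′‖ + ‖b − b′‖)`. [folklore] -/
theorem norm_pow_secondDiff_le {a b a' b' : 𝔄} {R : ℝ} (ha : ‖a‖ ≤ R) (hb : ‖b‖ ≤ R) (ha' : ‖a'‖ ≤ R) (hb' : ‖b'‖ ≤ R) :
    ∀ n : ℕ, ‖(a ^ (n + 2) - b ^ (n + 2)) - (a' ^ (n + 2) - b' ^ (n + 2))‖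
      ≤ (n + 2) * R ^ (n + 1) * ‖(a - b) - (a' - b')‖ + (n + 2) * (n + 1) * R ^ n * ‖a' - b'‖ * (‖a - a'‖ + ‖b - b'‖) := by
  have hR : 0 ≤ R := (norm_nonneg a).trans ha
  set E := ‖(a - b) - (a' - b')‖ with hE
  set D := ‖a' - b'‖ with hD
  set S := ‖a - a'‖ + ‖b - b'‖ with hS
  have hE0 : 0 ≤ E := norm_nonneg _
  have hD0 : 0 ≤ D := norm_nonneg _
  have hS0 : 0 ≤ S := by positivity
  -- the one-step estimate from the recurrence, for any exponent `m + 1`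
  have step : ∀ m : ℕ, ‖(a ^ (m + 2) - b ^ (m + 2)) - (a' ^ (m + 2) - b' ^ (m + 2))‖
      ≤ R * ‖(a ^ (m + 1) - b ^ (m + 1)) - (a' ^ (m + 1) - b' ^ (m + 1))‖
        + ‖a - a'‖ * ((m + 1) * R ^ m * D) + E * R ^ (m + 1) + D * ((m + 1) * R ^ m * ‖b - b'‖) := by
    intro m
    rw [secondDiff_succ a b a' b' (m + 1)]
    have t1 : ‖a * ((a ^ (m + 1) - b ^ (m + 1)) - (a' ^ (m + 1) - b' ^ (m + 1)))‖
        ≤ R * ‖(a ^ (m + 1) - b ^ (m + 1)) - (a' ^ (m + 1) - b' ^ (m + 1))‖ :=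
      (norm_mul_le _ _).trans (mul_le_mul_of_nonneg_right ha (norm_nonneg _))
    have t2 : ‖(a - a') * (a' ^ (m + 1) - b' ^ (m + 1))‖ ≤ ‖a - a'‖ * ((m + 1) * R ^ m * D) :=
      (norm_mul_le _ _).trans (mul_le_mul_of_nonneg_left (norm_pow_succ_sub_pow_succ_le_of_le ha' hb' m) (norm_nonneg _))
    have t3 : ‖((a - b) - (a' - b')) * b ^ (m + 1)‖ ≤ E * R ^ (m + 1) :=
      (norm_mul_le _ _).trans (mul_le_mul_of_nonneg_left
        ((norm_pow_le' b (Nat.succ_pos m)).trans (pow_le_pow_left₀ (norm_nonneg _) hb _)) (norm_nonneg _))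
    have t4 : ‖(a' - b') * (b ^ (m + 1) - b' ^ (m + 1))‖ ≤ D * ((m + 1) * R ^ m * ‖b - b'‖) :=
      (norm_mul_le _ _).trans (mul_le_mul_of_nonneg_left (norm_pow_succ_sub_pow_succ_le_of_le hb hb' m) (norm_nonneg _))
    calc _ ≤ ‖a * ((a ^ (m + 1) - b ^ (m + 1)) - (a' ^ (m + 1) - b' ^ (m + 1))) + (a - a') * (a' ^ (m + 1) - b' ^ (m + 1))
              + ((a - b) - (a' - b')) * b ^ (m + 1)‖ + ‖(a' - b') * (b ^ (m + 1) - b' ^ (m + 1))‖ := norm_add_le _ _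
      _ ≤ (‖a * ((a ^ (m + 1) - b ^ (m + 1)) - (a' ^ (m + 1) - b' ^ (m + 1))) + (a - a') * (a' ^ (m + 1) - b' ^ (m + 1))‖
              + ‖((a - b) - (a' - b')) * b ^ (m + 1)‖) + ‖(a' - b') * (b ^ (m + 1) - b' ^ (m + 1))‖ := by gcongr; exact norm_add_le _ _
      _ ≤ ((‖a * ((a ^ (m + 1) - b ^ (m + 1)) - (a' ^ (m + 1) - b' ^ (m + 1)))‖ + ‖(a - a') * (a' ^ (m + 1) - b' ^ (m + 1))‖)
              + ‖((a - b) - (a' - b')) * b ^ (m + 1)‖) + ‖(a' - b') * (b ^ (m + 1) - b' ^ (m + 1))‖ := by gcongr; exact norm_add_le _ _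
      _ ≤ _ := by linarith [t1, t2, t3, t4]
  intro n
  induction n with
  | zero =>
    -- exponent 2 from exponent 1 (`Δ₁ = e`)
    have h := step 0
    simp only [zero_add, pow_one, pow_zero, mul_one, Nat.cast_zero] at h ⊢
    have hb1 : ‖b - b'‖ ≤ S := by rw [hS]; linarith [norm_nonneg (a - a')]
    have ha1 : ‖a - a'‖ ≤ S := by rw [hS]; linarith [norm_nonneg (b - b')]
    nlinarith [h, hb1, ha1, hD0, hE0, hR, norm_nonneg (a - a'), norm_nonneg (b - b'), mul_nonneg hD0 hS0]
  | succ n ih =>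
    have h := step (n + 1)
    have hRn : 0 ≤ R ^ (n + 1) := pow_nonneg hR _
    have hRn' : 0 ≤ R ^ n := pow_nonneg hR _
    have hb1 : ‖b - b'‖ ≤ S := by rw [hS]; linarith [norm_nonneg (a - a')]
    have ha1 : ‖a - a'‖ ≤ S := by rw [hS]; linarith [norm_nonneg (b - b')]
    -- `R·[(n+2)R^{n+1}E + (n+2)(n+1)R^n D S] + ‖a−a′‖(n+2)R^{n+1}D + E R^{n+2} + D(n+2)R^{n+1}‖b−b′‖ ≤ (n+3)R^{n+2}E + (n+3)(n+2)R^{n+1}DS`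
    have key : R * ((n + 2) * R ^ (n + 1) * E + (n + 2) * (n + 1) * R ^ n * D * S)
        + ‖a - a'‖ * (((n + 1 : ℕ) + 1) * R ^ (n + 1) * D) + E * R ^ (n + 1 + 1) + D * (((n + 1 : ℕ) + 1) * R ^ (n + 1) * ‖b - b'‖)
        ≤ ((n + 1 : ℕ) + 2) * R ^ (n + 1 + 1) * E + ((n + 1 : ℕ) + 2) * ((n + 1 : ℕ) + 1) * R ^ (n + 1) * D * S := by
      push_cast
      have e1 : R * ((n + 2) * R ^ (n + 1) * E + (n + 2) * (n + 1) * R ^ n * D * S)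
          = (n + 2) * R ^ (n + 2) * E + (n + 2) * (n + 1) * (R ^ (n + 1)) * D * S := by ring
      rw [e1]
      have hsum : ‖a - a'‖ * ((n + 1 + 1) * R ^ (n + 1) * D) + D * ((n + 1 + 1) * R ^ (n + 1) * ‖b - b'‖)
          = (n + 2) * R ^ (n + 1) * D * (‖a - a'‖ + ‖b - b'‖) := by ring
      have hDS : (n + 2 : ℝ) * R ^ (n + 1) * D * (‖a - a'‖ + ‖b - b'‖) = (n + 2) * R ^ (n + 1) * D * S := by rw [hS]
      nlinarith [hsum, hDS, mul_nonneg (mul_nonneg hRn hD0) hS0, hE0, hRn]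
    calc _ ≤ _ := h
      _ ≤ R * ((n + 2) * R ^ (n + 1) * E + (n + 2) * (n + 1) * R ^ n * D * S)
          + ‖a - a'‖ * (((n + 1 : ℕ) + 1) * R ^ (n + 1) * D) + E * R ^ (n + 1 + 1) + D * (((n + 1 : ℕ) + 1) * R ^ (n + 1) * ‖b - b'‖) := by
            gcongr
      _ ≤ _ := key

end Powers

/-! ## §2 The exponential -/

section Exp

/-- ★★★ **SECOND DIFFERENCE OF THE EXPONENTIAL**: for `‖a‖, ‖b‖, ‖a′‖, ‖b′‖ ≤ R`,
`‖(eᵃ − eᵇ) − (e^{a′} − e^{b′})‖ ≤ e^R·(‖(a−b) − (a′−b′)‖ + ‖a′ − b′‖·(‖a − a′‖ + ‖b − b′‖))` (termwise: `Σ (n+2)Rⁿ⁺¹∕(n+2)! = e^R − 1`, `Σ (n+2)(n+1)Rⁿ∕(n+2)! = e^R`).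
[folklore] [cite: Balaban1985Averaging, (21)-(23) p.21] -/
theorem norm_exp_secondDiff_le {a b a' b' : 𝔄} {R : ℝ} (ha : ‖a‖ ≤ R) (hb : ‖b‖ ≤ R) (ha' : ‖a'‖ ≤ R) (hb' : ‖b'‖ ≤ R) :
    ‖(exp a - exp b) - (exp a' - exp b')‖
      ≤ Real.exp R * (‖(a - b) - (a' - b')‖ + ‖a' - b'‖ * (‖a - a'‖ + ‖b - b'‖)) := by
  have hR : 0 ≤ R := (norm_nonneg a).trans ha
  set E := ‖(a - b) - (a' - b')‖ with hE
  set D := ‖a' - b'‖ with hD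
  set S := ‖a - a'‖ + ‖b - b'‖ with hS
  have hE0 : 0 ≤ E := norm_nonneg _
  have hD0 : 0 ≤ D := norm_nonneg _
  have hS0 : 0 ≤ S := by positivity
  -- the series of the second difference
  have hsum := ((exp_series_hasSum_exp' (𝕂 := ℂ) a).sub (exp_series_hasSum_exp' (𝕂 := ℂ) b)).sub
    ((exp_series_hasSum_exp' (𝕂 := ℂ) a').sub (exp_series_hasSum_exp' (𝕂 := ℂ) b'))
  rw [← hsum.tsum_eq]
  -- dominating real series: `c 0 = 0`, `c 1 = E`, `c (n+2) = R^{n+1}/(n+1)!·E + R^n/n!·(D·S)`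
  set c : ℕ → ℝ := fun n => Nat.casesOn n 0 fun m => Nat.casesOn m E fun k => R ^ (k + 1) / (k + 1)! * E + R ^ k / k ! * (D * S) with hc
  have hreal : HasSum (fun n : ℕ => R ^ n / n !) (Real.exp R) := by
    have h := exp_series_hasSum_exp' (𝕂 := ℝ) R
    rw [← Real.exp_eq_exp_ℝ] at h
    simpa [smul_eq_mul, div_eq_inv_mul] using h
  -- `Σ_{n} c n = e^R·E + e^R·(D·S)`:
  have hE_part : HasSum (fun n : ℕ => Nat.casesOn n (0 : ℝ) fun m => R ^ m / m ! * E) (Real.exp R * E) := by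
    have h1 : HasSum (fun m : ℕ => R ^ m / m ! * E) (Real.exp R * E) := hreal.mul_right E
    refine (hasSum_nat_add_iff' 1).1 ?_
    simpa using h1
  have hDS_part : HasSum (fun n : ℕ => Nat.casesOn n (0 : ℝ) fun m => Nat.casesOn m (0 : ℝ) fun k => R ^ k / k ! * (D * S)) (Real.exp R * (D * S)) := by
    have h1 : HasSum (fun k : ℕ => R ^ k / k ! * (D * S)) (Real.exp R * (D * S)) := hreal.mul_right (D * S)
    refine (hasSum_nat_add_iff' 2).1 ?_
    simpa [Finset.sum_range_succ] using h1
  have hcsum : HasSum c (Real.exp R * (E + D * S)) := by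
    have h := hE_part.add hDS_part
    have heq : (fun n : ℕ => (Nat.casesOn n (0 : ℝ) fun m => R ^ m / m ! * E)
        + (Nat.casesOn n (0 : ℝ) fun m => Nat.casesOn m (0 : ℝ) fun k => R ^ k / k ! * (D * S))) = c := by
      funext n
      rcases n with _ | m
      · simp [hc]
      · rcases m with _ | k
        · simp [hc]
        · simp only [hc]
    rw [heq] at h
    convert h using 1
    ring
  refine tsum_of_norm_bounded hcsum fun n => ?_
  rcases n with _ | m
  · simp [hc]
  · rcases m with _ | k
    · -- n = 1: the term is `1 • ((a − b) − (a′ − b′))`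
      simp [hc, hE]
    · -- n = k + 2
      simp only [hc]
      rw [← smul_sub, ← smul_sub, ← smul_sub, norm_smul, norm_inv, Complex.norm_natCast]
      have hpow := norm_pow_secondDiff_le ha hb ha' hb' k
      have hfac : ((k + 2)! : ℝ) = (k + 2) * ((k + 1) * k !) := by push_cast [Nat.factorial_succ]; ring
      have hfac1 : ((k + 1)! : ℝ) = (k + 1) * k ! := by push_cast [Nat.factorial_succ]; ring
      have hk0 : (0 : ℝ) < k ! := by positivity
      rw [hfac, hfac1]
      rw [inv_mul_le_iff₀ (by positivity)]
      calc ‖(a ^ (k + 2) - b ^ (k + 2)) - (a' ^ (k + 2) - b' ^ (k + 2))‖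
          ≤ (k + 2) * R ^ (k + 1) * E + (k + 2) * (k + 1) * R ^ k * D * S := hpow
        _ = (k + 2) * ((k + 1) * k !) * (R ^ (k + 1) / ((k + 1) * k !) * E + R ^ k / k ! * (D * S)) := by
            field_simp

end Exp

end Summit.QuantumFields.YangMills.Theorems.Prop7PowerSeriesSecondDiff

end
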